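import Mathlib.Analysis.PSeries
import Mathlib.Analysis.SpecialFunctions.Pow.Real
import Literature.Analysis.Fourier.SobolevEmbeddingCircle   -- ★ `summable_one_add_intSq_rpow_neg`: `Σ_{n ∈ ℤ} (1+n²)^{-p} < ∞`, `p > 1/2`
import HarnessLib

/-!
# Lattice sums with polynomial weights: `Σ_{(a,b,c) ∈ ℤ³} (1+|a|)^k (1+a²+b²+c²)^{-N} < ∞`

Topic `Analysis/SpecialFunctions`; namespace `Literature.Analysis.SpecialFunctions`; THEOREMS ONLY (no `def`, no instance, no notation, no `sorry`);
Mathlib + one light ★ lemma.  Cell `hodgecm-mathlib`, F0∕P3, T1a arch line, road HC for the letter A5 ★ `UnitaryGroup.ArchIntegratedOperatorTraceClass`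
([Knapp1986, Thm. 10.2]): node **H4a** — the SUMMABILITY HALF of [Varadarajan1989, §5.4, Lemma 21] (LEAD F0P3b-p01 (g2) 2026-08-31T17:12:44Z (2)).

THE PRINT.  In the proof that `π(f)` is of trace class for `π` irreducible unitary and `f ∈ C_c^∞(G)` ([Knapp1986, Thm. 10.2]; [Varadarajan1989, §5.4,
Thms. 19, 22 and Lemma 21]) one bounds `‖π(f)|_{E(τ)}‖ ≤ c(τ)^{-N} ‖Ω^N f‖₁` for every `K`-type `τ` (`c(τ) ≥ 1` the eigenvalue of `1 + ω_K`), the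
multiplicities by `m(τ) ≤ C d(τ)^r`, and is left with the LATTICE SUM `Σ_τ d(τ)^{r+1} c(τ)^{-N}` over `K̂`; for `K = U(2) × U(1)` the `K`-types are labelled by
lattice points `(a, b, c)` (`a ≥ 0`), `d(τ) = a + 1` and `c(τ)` is an explicit positive-definite quadratic expression in the label, so the sum is dominated by
`Σ_{ℤ³} (1+|a|)^k (1+a²+b²+c²)^{-N}`, finite for `N` large [Varadarajan1989, Lemma 21: «`Σ_ξ d(ξ)^p c(ξ)^{-q} < ∞` for `q` large»].  This file proves exactly these
elementary convergence statements, in a form the dictionary node (H4b: `Û(2)×Û(1) ↔` labels) plugs into with no further analysis.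

THE LEAN TEXT.
* §1 (`ℤ`): `summable_int_one_add_abs_pow_mul_rpow_neg`: `Σ_n (1+|n|)^k (1+n²)^{-s} < ∞` for `k + 1 < 2s` (comparison with `Σ |n|^{-(2s-k)}`,
  Mathlib `Real.summable_abs_int_rpow`, off `n = 0`).
* §2 (`ℤ³`): `summable_int3_one_add_abs_pow_mul_rpow_neg`: `Σ (1+|a|)^k (1+(a²+b²+c²))^{-N} < ∞` for `k + 3 < 2N` (the sharp threshold; split
  `N = s₁ + s₂ + s₂`, `(1+a²+b²+c²)^{-N} ≤ (1+a²)^{-s₁}(1+b²)^{-s₂}(1+c²)^{-s₂}`, Mathlib `Summable.mul_of_nonneg`); the symmetric weight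
  `summable_int3_one_add_abs_add_pow_mul_rpow_neg`: `Σ (1+|a|+|b|+|c|)^k (…)^{-N} < ∞` for `3(k+1) < 2N`.
* §3 variants: `ℕ × ℤ × ℤ` with weight `(a+1)^k` (`summable_nat_int2_add_one_pow_mul_rpow_neg`); natural powers `… / (1+a²+b²+c²)^m`, `k + 4 ≤ 2m`
  (`summable_int3_one_add_abs_pow_div_pow`).
* §4 THE CONSUMABLE WRAPPER `summable_pow_mul_rpow_neg_of_injective_label`: for ANY index type `ι` (the `K`-types, or the irreducible blocks) with an
  INJECTIVE label `w : ι → ℤ × ℤ × ℤ`, dimensions `0 ≤ d i ≤ C (1+|a|+|b|+|c|)` and eigenvalues `q i ≥ δ (1+a²+b²+c²)` (`δ > 0`):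
  `Summable (fun i => d i ^ k * q i ^ (-N))` for `3(k+1) < 2N` (+ `_fst`: `d i ≤ C (1+|a|)`, `k + 3 < 2N`).
* §5 THE BLOCK FORM `summable_pow_mul_rpow_neg_of_label_fiber_le` (LEAD F0P3b-p01 (g2) 17:17:37Z: the index of ★ `traceClass_clauses_of_forall_decomposition`
  is the set of irreducible `K`-BLOCKS, on which the label is only FINITE-TO-ONE): fibres `#w⁻¹(t) ≤ C'(1+|t.1|)` (the multiplicity bound
  [Varadarajan1989, §5.4 Thm. 19]), `d i ≤ C(1+|a|)`, `q i ≥ δ(1+a²+b²+c²)` ⇒ `Summable (fun i => d i ^ k * q i ^ (-N))` for `(k+1) + 3 < 2N`.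
* §6 (ED. 2, appended; ED. 1 text byte-unchanged): `summable_pow_mul_rpow_neg_of_label_fiber_le_pow` — the same with a POLYNOMIAL fibre bound
  `#w⁻¹(t) ≤ C'(1+|t.1|)^m`, threshold `(k+m) + 3 < 2N` (LEAD F0P3b-p01 (g2) 17:25:59Z: general growth exponent).
HONEST LABEL: elementary real analysis; closes no registered stub by itself (H4b, H3, H5 remain).  HC_CM is proved only modulo the 2 remaining named inputs
(hLiu418, h413) — behind them the booked printed statements + the MOD package — until rung 0 closes.

## References
* V. S. Varadarajan, *An Introduction to Harmonic Analysis on Semisimple Lie Groups*, Cambridge (1989), §5.4, Thm. 19, Lemma 21, Thm. 22 [Varadarajan1989].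
* A. W. Knapp, *Representation Theory of Semisimple Groups: An Overview Based on Examples*, Princeton (1986), Thm. 10.2 and its proof [Knapp1986].
* R. Kress, *Linear Integral Equations*, 2nd ed. (1999), §8.1 Thm. 8.4 (the series `Σ(1+m²)^{-p}`) [Kress1999].
-/

set_option autoImplicit false

noncomputable section

open Real

namespace Literature.Analysis.SpecialFunctions

/-! ## §1 One dimension: `Σ_{n ∈ ℤ} (1+|n|)^k (1+n²)^{-s} < ∞` for `k + 1 < 2s` -/

/-- **Weighted `p`-series over `ℤ`**: `Σ_{n ∈ ℤ} (1+|n|)^k (1+n²)^{-s}` converges as soon as `k + 1 < 2s` (off `n = 0` the term is at most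
`2^k |n|^{-(2s-k)}`, and `2s - k > 1`; Mathlib `Real.summable_abs_int_rpow`). [cite: Varadarajan1989, §5.4 Lemma 21] [cite: Kress1999, §8.1, Thm 8.4 (proof)] -/
theorem summable_int_one_add_abs_pow_mul_rpow_neg (k : ℕ) {s : ℝ} (hs : (k : ℝ) + 1 < 2 * s) :
    Summable fun n : ℤ => (1 + |(n : ℝ)|) ^ k * (1 + (n : ℝ) ^ 2) ^ (-s) := by
  have hb : 1 < 2 * s - k := by linarith
  have h1 : Summable fun n : ℤ => (2 : ℝ) ^ k * |(n : ℝ)| ^ (-(2 * s - k)) :=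
    (Real.summable_abs_int_rpow hb).mul_left _
  have h2 : Summable (Function.update (fun n : ℤ => (2 : ℝ) ^ k * |(n : ℝ)| ^ (-(2 * s - k))) 0 1) := h1.update 0 1
  refine Summable.of_nonneg_of_le (fun n => by positivity) (fun n => ?_) h2
  rcases eq_or_ne n 0 with rfl | hn
  · simp
  · rw [Function.update_of_ne hn]
    have hnpos : 0 < |(n : ℝ)| := abs_pos.mpr (Int.cast_ne_zero.mpr hn)
    have hn1 : 1 ≤ |(n : ℝ)| := by
      rw [← Int.cast_abs]
      exact_mod_cast Int.one_le_abs hn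
    -- `(1+|n|)^k ≤ (2|n|)^k = 2^k |n|^k`
    have hw : (1 + |(n : ℝ)|) ^ k ≤ (2 : ℝ) ^ k * |(n : ℝ)| ^ (k : ℝ) := by
      rw [Real.rpow_natCast, ← mul_pow]
      exact pow_le_pow_left₀ (by positivity) (by linarith) k
    -- `(1+n²)^{-s} ≤ |n|^{-2s}`
    have hq : (1 + (n : ℝ) ^ 2) ^ (-s) ≤ |(n : ℝ)| ^ (-(2 * s)) := by
      have hsq : |(n : ℝ)| ^ 2 ≤ 1 + (n : ℝ) ^ 2 := by rw [sq_abs]; linarith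
      calc (1 + (n : ℝ) ^ 2) ^ (-s) ≤ (|(n : ℝ)| ^ 2) ^ (-s) :=
            Real.rpow_le_rpow_of_nonpos (by positivity) hsq (by linarith)
        _ = |(n : ℝ)| ^ (-(2 * s)) := by
            rw [← Real.rpow_natCast, ← Real.rpow_mul hnpos.le]
            norm_num
    calc (1 + |(n : ℝ)|) ^ k * (1 + (n : ℝ) ^ 2) ^ (-s)
        ≤ ((2 : ℝ) ^ k * |(n : ℝ)| ^ (k : ℝ)) * |(n : ℝ)| ^ (-(2 * s)) :=
          mul_le_mul hw hq (by positivity) (by positivity)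
      _ = (2 : ℝ) ^ k * |(n : ℝ)| ^ (-(2 * s - k)) := by
          rw [mul_assoc, ← Real.rpow_add hnpos]
          congr 2
          ring

/-- Non-negativity of the one-dimensional term. [cite: Varadarajan1989, §5.4 Lemma 21] -/
theorem one_add_abs_pow_mul_rpow_neg_nonneg (k : ℕ) (s : ℝ) (n : ℤ) :
    0 ≤ (1 + |(n : ℝ)|) ^ k * (1 + (n : ℝ) ^ 2) ^ (-s) := by
  positivity

/-! ## §2 Three dimensions: `Σ_{ℤ³} (1+|a|)^k (1+a²+b²+c²)^{-N} < ∞` -/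

/-- The key comparison: for `s₁, s₂, s₃ ≥ 0`, `(1 + a² + b² + c²)^{-(s₁+s₂+s₃)} ≤ (1+a²)^{-s₁} (1+b²)^{-s₂} (1+c²)^{-s₃}` (each factor `1 + x²` is at
most the full quadratic). [cite: Varadarajan1989, §5.4 Lemma 21] -/
theorem rpow_neg_quadratic_le_prod {s₁ s₂ s₃ : ℝ} (h₁ : 0 ≤ s₁) (h₂ : 0 ≤ s₂) (h₃ : 0 ≤ s₃) (a b c : ℝ) :
    (1 + (a ^ 2 + b ^ 2 + c ^ 2)) ^ (-(s₁ + s₂ + s₃)) ≤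
      (1 + a ^ 2) ^ (-s₁) * ((1 + b ^ 2) ^ (-s₂) * (1 + c ^ 2) ^ (-s₃)) := by
  set Q : ℝ := 1 + (a ^ 2 + b ^ 2 + c ^ 2) with hQ
  have hQpos : 0 < Q := by positivity
  have hQa : (1 + a ^ 2) ≤ Q := by rw [hQ]; nlinarith [sq_nonneg b, sq_nonneg c]
  have hQb : (1 + b ^ 2) ≤ Q := by rw [hQ]; nlinarith [sq_nonneg a, sq_nonneg c]
  have hQc : (1 + c ^ 2) ≤ Q := by rw [hQ]; nlinarith [sq_nonneg a, sq_nonneg b]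
  have hsplit : Q ^ (-(s₁ + s₂ + s₃)) = Q ^ (-s₁) * (Q ^ (-s₂) * Q ^ (-s₃)) := by
    rw [show -(s₁ + s₂ + s₃) = -s₁ + (-s₂ + -s₃) by ring, Real.rpow_add hQpos, Real.rpow_add hQpos]
  rw [hsplit]
  have ha' : Q ^ (-s₁) ≤ (1 + a ^ 2) ^ (-s₁) := Real.rpow_le_rpow_of_nonpos (by positivity) hQa (by linarith)
  have hb' : Q ^ (-s₂) ≤ (1 + b ^ 2) ^ (-s₂) := Real.rpow_le_rpow_of_nonpos (by positivity) hQb (by linarith)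
  have hc' : Q ^ (-s₃) ≤ (1 + c ^ 2) ^ (-s₃) := Real.rpow_le_rpow_of_nonpos (by positivity) hQc (by linarith)
  exact mul_le_mul ha' (mul_le_mul hb' hc' (by positivity) (by positivity)) (by positivity) (by positivity)

/-- **The lattice sum of the road** (sharp threshold): `Σ_{(a,b,c) ∈ ℤ³} (1+|a|)^k (1+(a²+b²+c²))^{-N} < ∞` whenever `k + 3 < 2N` (split
`N = s₁ + s₂ + s₂` with `k + 1 < 2s₁`, `1 < 2s₂`; `rpow_neg_quadratic_le_prod`; Mathlib `Summable.mul_of_nonneg`).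
[cite: Varadarajan1989, §5.4 Lemma 21] [cite: Knapp1986, Thm. 10.2 (proof)] -/
theorem summable_int3_one_add_abs_pow_mul_rpow_neg (k : ℕ) {N : ℝ} (hN : (k : ℝ) + 3 < 2 * N) :
    Summable fun p : ℤ × ℤ × ℤ =>
      (1 + |(p.1 : ℝ)|) ^ k * (1 + ((p.1 : ℝ) ^ 2 + (p.2.1 : ℝ) ^ 2 + (p.2.2 : ℝ) ^ 2)) ^ (-N) := by
  -- the split `N = s₁ + s₂ + s₂`
  set t : ℝ := (2 * N - k - 3) / 6 with ht
  have htpos : 0 < t := by rw [ht]; linarith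
  set s₂ : ℝ := 1 / 2 + t with hs₂
  set s₁ : ℝ := N - 2 * s₂ with hs₁
  have hs₁k : (k : ℝ) + 1 < 2 * s₁ := by rw [hs₁, hs₂, ht]; linarith
  have hs₂h : 1 / 2 < s₂ := by rw [hs₂]; linarith
  have hs₁0 : 0 ≤ s₁ := by
    have : (0 : ℝ) ≤ k := Nat.cast_nonneg k
    linarith
  have hs₂0 : 0 ≤ s₂ := by linarith
  have hNsplit : N = s₁ + s₂ + s₂ := by rw [hs₁]; ring
  -- the three one-dimensional series
  have hf₁ := summable_int_one_add_abs_pow_mul_rpow_neg k hs₁k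
  have hf₂ : Summable fun n : ℤ => (1 + (n : ℝ) ^ 2) ^ (-s₂) := Literature.Analysis.Fourier.summable_one_add_intSq_rpow_neg hs₂h
  have hprod : Summable fun p : ℤ × ℤ × ℤ =>
      ((1 + |(p.1 : ℝ)|) ^ k * (1 + (p.1 : ℝ) ^ 2) ^ (-s₁)) *
        ((1 + (p.2.1 : ℝ) ^ 2) ^ (-s₂) * (1 + (p.2.2 : ℝ) ^ 2) ^ (-s₂)) :=
    hf₁.mul_of_nonneg (hf₂.mul_of_nonneg hf₂ (fun n => by positivity) (fun n => by positivity))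
      (fun n => by positivity) (fun p => by positivity)
  refine Summable.of_nonneg_of_le (fun p => by positivity) (fun p => ?_) hprod
  rw [mul_assoc]
  refine mul_le_mul_of_nonneg_left ?_ (by positivity)
  rw [hNsplit]
  exact rpow_neg_quadratic_le_prod hs₁0 hs₂0 hs₂0 _ _ _

/-- **Symmetric weight**: `Σ_{(a,b,c) ∈ ℤ³} (1+|a|+|b|+|c|)^k (1+(a²+b²+c²))^{-N} < ∞` whenever `3(k+1) < 2N`
(`1+|a|+|b|+|c| ≤ (1+|a|)(1+|b|)(1+|c|)` and the split `N = 3s`, `k + 1 < 2s`). [cite: Varadarajan1989, §5.4 Lemma 21] -/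
theorem summable_int3_one_add_abs_add_pow_mul_rpow_neg (k : ℕ) {N : ℝ} (hN : 3 * ((k : ℝ) + 1) < 2 * N) :
    Summable fun p : ℤ × ℤ × ℤ =>
      (1 + |(p.1 : ℝ)| + |(p.2.1 : ℝ)| + |(p.2.2 : ℝ)|) ^ k *
        (1 + ((p.1 : ℝ) ^ 2 + (p.2.1 : ℝ) ^ 2 + (p.2.2 : ℝ) ^ 2)) ^ (-N) := by
  set s : ℝ := N / 3 with hs
  have hsk : (k : ℝ) + 1 < 2 * s := by rw [hs]; linarith
  have hs0 : 0 ≤ s := by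
    have : (0 : ℝ) ≤ k := Nat.cast_nonneg k
    linarith
  have hNsplit : N = s + s + s := by rw [hs]; ring
  have hf := summable_int_one_add_abs_pow_mul_rpow_neg k hsk
  have hprod : Summable fun p : ℤ × ℤ × ℤ =>
      ((1 + |(p.1 : ℝ)|) ^ k * (1 + (p.1 : ℝ) ^ 2) ^ (-s)) *
        (((1 + |(p.2.1 : ℝ)|) ^ k * (1 + (p.2.1 : ℝ) ^ 2) ^ (-s)) *
          ((1 + |(p.2.2 : ℝ)|) ^ k * (1 + (p.2.2 : ℝ) ^ 2) ^ (-s))) :=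
    hf.mul_of_nonneg (hf.mul_of_nonneg hf (fun n => by positivity) (fun n => by positivity))
      (fun n => by positivity) (fun p => by positivity)
  refine Summable.of_nonneg_of_le (fun p => by positivity) (fun p => ?_) hprod
  obtain ⟨a, b, c⟩ := p
  dsimp only
  -- weight: `(1+|a|+|b|+|c|)^k ≤ ((1+|a|)(1+|b|)(1+|c|))^k`
  have hw : (1 + |(a : ℝ)| + |(b : ℝ)| + |(c : ℝ)|) ^ k ≤
      ((1 + |(a : ℝ)|) * ((1 + |(b : ℝ)|) * (1 + |(c : ℝ)|))) ^ k := by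
    refine pow_le_pow_left₀ (by positivity) ?_ k
    nlinarith [abs_nonneg (a : ℝ), abs_nonneg (b : ℝ), abs_nonneg (c : ℝ),
      mul_nonneg (abs_nonneg (a : ℝ)) (abs_nonneg (b : ℝ)), mul_nonneg (abs_nonneg (a : ℝ)) (abs_nonneg (c : ℝ)),
      mul_nonneg (abs_nonneg (b : ℝ)) (abs_nonneg (c : ℝ)),
      mul_nonneg (mul_nonneg (abs_nonneg (a : ℝ)) (abs_nonneg (b : ℝ))) (abs_nonneg (c : ℝ))]
  have hq : (1 + ((a : ℝ) ^ 2 + (b : ℝ) ^ 2 + (c : ℝ) ^ 2)) ^ (-N) ≤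
      (1 + (a : ℝ) ^ 2) ^ (-s) * ((1 + (b : ℝ) ^ 2) ^ (-s) * (1 + (c : ℝ) ^ 2) ^ (-s)) := by
    rw [hNsplit]
    exact rpow_neg_quadratic_le_prod hs0 hs0 hs0 _ _ _
  calc (1 + |(a : ℝ)| + |(b : ℝ)| + |(c : ℝ)|) ^ k * (1 + ((a : ℝ) ^ 2 + (b : ℝ) ^ 2 + (c : ℝ) ^ 2)) ^ (-N)
      ≤ ((1 + |(a : ℝ)|) * ((1 + |(b : ℝ)|) * (1 + |(c : ℝ)|))) ^ k *
          ((1 + (a : ℝ) ^ 2) ^ (-s) * ((1 + (b : ℝ) ^ 2) ^ (-s) * (1 + (c : ℝ) ^ 2) ^ (-s))) :=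
        mul_le_mul hw hq (by positivity) (by positivity)
    _ = ((1 + |(a : ℝ)|) ^ k * (1 + (a : ℝ) ^ 2) ^ (-s)) *
          (((1 + |(b : ℝ)|) ^ k * (1 + (b : ℝ) ^ 2) ^ (-s)) * ((1 + |(c : ℝ)|) ^ k * (1 + (c : ℝ) ^ 2) ^ (-s))) := by
        rw [mul_pow, mul_pow]; ring

/-! ## §3 Variants: labels `a ≥ 0` in `ℕ`, and natural-number powers -/

/-- **`ℕ × ℤ × ℤ` form** (labels with `a ≥ 0`, weight `(a+1)^k` — the dimension `d = a + 1` of the print):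
`Σ_{a ≥ 0, b, c} (a+1)^k (1+(a²+b²+c²))^{-N} < ∞` for `k + 3 < 2N`. [cite: Varadarajan1989, §5.4 Lemma 21] [cite: Knapp1986, Thm. 10.2 (proof)] -/
theorem summable_nat_int2_add_one_pow_mul_rpow_neg (k : ℕ) {N : ℝ} (hN : (k : ℝ) + 3 < 2 * N) :
    Summable fun p : ℕ × ℤ × ℤ =>
      ((p.1 : ℝ) + 1) ^ k * (1 + ((p.1 : ℝ) ^ 2 + (p.2.1 : ℝ) ^ 2 + (p.2.2 : ℝ) ^ 2)) ^ (-N) := by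
  have hinj : Function.Injective (fun p : ℕ × ℤ × ℤ => ((p.1 : ℤ), p.2)) := by
    rintro ⟨a, bc⟩ ⟨a', bc'⟩ h
    simp only [Prod.mk.injEq, Nat.cast_inj] at h
    rw [h.1, h.2]
  have h := (summable_int3_one_add_abs_pow_mul_rpow_neg k hN).comp_injective hinj
  refine h.congr fun p => ?_
  simp only [Function.comp_apply, Int.cast_natCast, Nat.abs_cast]
  rw [add_comm (1 : ℝ) (p.1 : ℝ)]

/-- **Natural-power form**: `Σ_{(a,b,c) ∈ ℤ³} (1+|a|)^k / (1+a²+b²+c²)^m < ∞` for natural `m` with `k + 4 ≤ 2m`.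
[cite: Varadarajan1989, §5.4 Lemma 21] -/
theorem summable_int3_one_add_abs_pow_div_pow (k m : ℕ) (hm : k + 4 ≤ 2 * m) :
    Summable fun p : ℤ × ℤ × ℤ =>
      (1 + |(p.1 : ℝ)|) ^ k / (1 + ((p.1 : ℝ) ^ 2 + (p.2.1 : ℝ) ^ 2 + (p.2.2 : ℝ) ^ 2)) ^ m := by
  have hN : (k : ℝ) + 3 < 2 * (m : ℝ) := by
    have h : ((k + 4 : ℕ) : ℝ) ≤ ((2 * m : ℕ) : ℝ) := Nat.cast_le.mpr hm
    push_cast at h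
    linarith
  refine (summable_int3_one_add_abs_pow_mul_rpow_neg k hN).congr fun p => ?_
  rw [Real.rpow_neg (by positivity), Real.rpow_natCast, div_eq_mul_inv]

/-! ## §4 The consumable wrapper: any index type with an injective lattice label -/

/-- **Summability over `K`-types ∕ blocks from an injective lattice label** (the form the dictionary node H4b plugs into): let `ι` be any index type with
an INJECTIVE label `w : ι → ℤ × ℤ × ℤ`, «dimensions» `0 ≤ d i ≤ C · (1 + |a| + |b| + |c|)` and «eigenvalues» `q i ≥ δ · (1 + a² + b² + c²)` (`δ > 0`), where
`(a, b, c) = w i`.  Then `Σ_i d(i)^k q(i)^{-N} < ∞` for `3(k+1) < 2N`. [cite: Varadarajan1989, §5.4 Lemma 21] [cite: Knapp1986, Thm. 10.2 (proof)] -/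
theorem summable_pow_mul_rpow_neg_of_injective_label {ι : Type*} (w : ι → ℤ × ℤ × ℤ) (hw : Function.Injective w)
    {d q : ι → ℝ} {C δ : ℝ} (hδ : 0 < δ) (hd0 : ∀ i, 0 ≤ d i)
    (hd : ∀ i, d i ≤ C * (1 + |((w i).1 : ℝ)| + |((w i).2.1 : ℝ)| + |((w i).2.2 : ℝ)|))
    (hq : ∀ i, δ * (1 + (((w i).1 : ℝ) ^ 2 + ((w i).2.1 : ℝ) ^ 2 + ((w i).2.2 : ℝ) ^ 2)) ≤ q i)
    (k : ℕ) {N : ℝ} (hN : 3 * ((k : ℝ) + 1) < 2 * N) :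
    Summable fun i => d i ^ k * q i ^ (-N) := by
  -- the dominating lattice series, transported along the injective label
  have hlat := ((summable_int3_one_add_abs_add_pow_mul_rpow_neg k hN).comp_injective hw).mul_left (C ^ k * δ ^ (-N))
  refine Summable.of_nonneg_of_le (fun i => ?_) (fun i => ?_) hlat
  · have hqpos : 0 < q i := lt_of_lt_of_le (by have := hq i; positivity) (hq i)
    exact mul_nonneg (pow_nonneg (hd0 i) k) (Real.rpow_nonneg hqpos.le _)
  · simp only [Function.comp_apply]
    set a : ℝ := ((w i).1 : ℝ)
    set b : ℝ := ((w i).2.1 : ℝ)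
    set c : ℝ := ((w i).2.2 : ℝ)
    have hQpos : 0 < δ * (1 + (a ^ 2 + b ^ 2 + c ^ 2)) := by positivity
    have hC : 0 ≤ C := nonneg_of_mul_nonneg_left ((hd0 i).trans (hd i)) (by positivity)
    -- `d^k ≤ C^k (1+|a|+|b|+|c|)^k`
    have h1 : d i ^ k ≤ C ^ k * (1 + |a| + |b| + |c|) ^ k := by
      rw [← mul_pow]
      exact pow_le_pow_left₀ (hd0 i) (hd i) k
    -- `q^{-N} ≤ (δ Q)^{-N} = δ^{-N} Q^{-N}`
    have h2 : q i ^ (-N) ≤ δ ^ (-N) * (1 + (a ^ 2 + b ^ 2 + c ^ 2)) ^ (-N) := by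
      rw [← Real.mul_rpow hδ.le (by positivity)]
      exact Real.rpow_le_rpow_of_nonpos hQpos (hq i) (by linarith)
    calc d i ^ k * q i ^ (-N)
        ≤ (C ^ k * (1 + |a| + |b| + |c|) ^ k) * (δ ^ (-N) * (1 + (a ^ 2 + b ^ 2 + c ^ 2)) ^ (-N)) :=
          mul_le_mul h1 h2 (Real.rpow_nonneg (le_of_lt (lt_of_lt_of_le hQpos (hq i))) _) (by positivity)
      _ = C ^ k * δ ^ (-N) * ((1 + |a| + |b| + |c|) ^ k * (1 + (a ^ 2 + b ^ 2 + c ^ 2)) ^ (-N)) := by ring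

/-- **First-coordinate form of the wrapper** (sharp threshold): if the dimensions are controlled by the FIRST label alone, `0 ≤ d i ≤ C (1+|a|)`, then
`Σ_i d(i)^k q(i)^{-N} < ∞` already for `k + 3 < 2N`. [cite: Varadarajan1989, §5.4 Lemma 21] -/
theorem summable_pow_mul_rpow_neg_of_injective_label_fst {ι : Type*} (w : ι → ℤ × ℤ × ℤ) (hw : Function.Injective w)
    {d q : ι → ℝ} {C δ : ℝ} (hδ : 0 < δ) (hd0 : ∀ i, 0 ≤ d i) (hd : ∀ i, d i ≤ C * (1 + |((w i).1 : ℝ)|))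
    (hq : ∀ i, δ * (1 + (((w i).1 : ℝ) ^ 2 + ((w i).2.1 : ℝ) ^ 2 + ((w i).2.2 : ℝ) ^ 2)) ≤ q i)
    (k : ℕ) {N : ℝ} (hN : (k : ℝ) + 3 < 2 * N) :
    Summable fun i => d i ^ k * q i ^ (-N) := by
  have hlat := ((summable_int3_one_add_abs_pow_mul_rpow_neg k hN).comp_injective hw).mul_left (C ^ k * δ ^ (-N))
  refine Summable.of_nonneg_of_le (fun i => ?_) (fun i => ?_) hlat
  · have hqpos : 0 < q i := lt_of_lt_of_le (by have := hq i; positivity) (hq i)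
    exact mul_nonneg (pow_nonneg (hd0 i) k) (Real.rpow_nonneg hqpos.le _)
  · simp only [Function.comp_apply]
    set a : ℝ := ((w i).1 : ℝ)
    set b : ℝ := ((w i).2.1 : ℝ)
    set c : ℝ := ((w i).2.2 : ℝ)
    have hQpos : 0 < δ * (1 + (a ^ 2 + b ^ 2 + c ^ 2)) := by positivity
    have hC : 0 ≤ C := nonneg_of_mul_nonneg_left ((hd0 i).trans (hd i)) (by positivity)
    have h1 : d i ^ k ≤ C ^ k * (1 + |a|) ^ k := by
      rw [← mul_pow]
      exact pow_le_pow_left₀ (hd0 i) (hd i) k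
    have h2 : q i ^ (-N) ≤ δ ^ (-N) * (1 + (a ^ 2 + b ^ 2 + c ^ 2)) ^ (-N) := by
      rw [← Real.mul_rpow hδ.le (by positivity)]
      exact Real.rpow_le_rpow_of_nonpos hQpos (hq i) (by linarith)
    calc d i ^ k * q i ^ (-N)
        ≤ (C ^ k * (1 + |a|) ^ k) * (δ ^ (-N) * (1 + (a ^ 2 + b ^ 2 + c ^ 2)) ^ (-N)) :=
          mul_le_mul h1 h2 (Real.rpow_nonneg (le_of_lt (lt_of_lt_of_le hQpos (hq i))) _) (by positivity)
      _ = C ^ k * δ ^ (-N) * ((1 + |a|) ^ k * (1 + (a ^ 2 + b ^ 2 + c ^ 2)) ^ (-N)) := by ring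


/-! ## §5 Finite-to-one labels: the block form (fibres bounded by the multiplicity estimate) -/

/-- **Block form of the wrapper (finite-to-one label)** — the currency of ★ `traceClass_clauses_of_forall_decomposition` (index `ι` = the irreducible
`K`-BLOCKS of `ϖ|_K`; blocks of the same `K`-type share the label): if every fibre of the label `w : ι → ℤ × ℤ × ℤ` is finite with
`#w⁻¹(t) ≤ C' (1 + |t.1|)` (the multiplicity bound [Varadarajan1989, §5.4 Thm. 19]: `m(τ) ≤ c · d(τ)`, `d = a + 1`), `0 ≤ d i ≤ C (1 + |a|)` and
`q i ≥ δ (1 + a² + b² + c²)` (`δ > 0`), then `Σ_i d(i)^k q(i)^{-N} < ∞` for `(k+1) + 3 < 2N` (fibrewise along `Equiv.sigmaFiberEquiv w` with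
`summable_sigma_of_nonneg`: each fibre sum is `≤ C'(1+|a|) · |C|^k (1+|a|)^k · δ^{-N} (1+a²+b²+c²)^{-N}`, summable over `ℤ³` by
`summable_int3_one_add_abs_pow_mul_rpow_neg (k+1)`). [cite: Varadarajan1989, §5.4 Lemma 21, Thm. 19] [cite: Knapp1986, Thm. 10.2 (proof)] -/
theorem summable_pow_mul_rpow_neg_of_label_fiber_le {ι : Type*} (w : ι → ℤ × ℤ × ℤ)
    (hfin : ∀ t, (w ⁻¹' {t}).Finite) {C' : ℝ} (hfib : ∀ t, (Nat.card (w ⁻¹' {t}) : ℝ) ≤ C' * (1 + |(t.1 : ℝ)|))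
    {d q : ι → ℝ} {C δ : ℝ} (hδ : 0 < δ) (hd0 : ∀ i, 0 ≤ d i) (hd : ∀ i, d i ≤ C * (1 + |((w i).1 : ℝ)|))
    (hq : ∀ i, δ * (1 + (((w i).1 : ℝ) ^ 2 + ((w i).2.1 : ℝ) ^ 2 + ((w i).2.2 : ℝ) ^ 2)) ≤ q i)
    (k : ℕ) {N : ℝ} (hN : ((k : ℝ) + 1) + 3 < 2 * N) :
    Summable fun i => d i ^ k * q i ^ (-N) := by
  -- the fibrewise-constant majorant `h (w i)` of the term
  set h : ℤ × ℤ × ℤ → ℝ := fun t =>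
    |C| ^ k * δ ^ (-N) * ((1 + |(t.1 : ℝ)|) ^ k * (1 + ((t.1 : ℝ) ^ 2 + (t.2.1 : ℝ) ^ 2 + (t.2.2 : ℝ) ^ 2)) ^ (-N)) with hh
  have hh0 : ∀ t, 0 ≤ h t := fun t => by positivity
  have hqpos : ∀ i, 0 < q i := fun i => lt_of_lt_of_le (by have := hq i; positivity) (hq i)
  have hf0 : ∀ i, 0 ≤ d i ^ k * q i ^ (-N) := fun i => mul_nonneg (pow_nonneg (hd0 i) k) (Real.rpow_nonneg (hqpos i).le _)
  have hfh : ∀ i, d i ^ k * q i ^ (-N) ≤ h (w i) := by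
    intro i
    simp only [hh]
    set a : ℝ := ((w i).1 : ℝ)
    set b : ℝ := ((w i).2.1 : ℝ)
    set c : ℝ := ((w i).2.2 : ℝ)
    have hQpos : 0 < δ * (1 + (a ^ 2 + b ^ 2 + c ^ 2)) := by positivity
    have hd' : d i ≤ |C| * (1 + |a|) := (hd i).trans (mul_le_mul_of_nonneg_right (le_abs_self C) (by positivity))
    have h1 : d i ^ k ≤ |C| ^ k * (1 + |a|) ^ k := by
      rw [← mul_pow]
      exact pow_le_pow_left₀ (hd0 i) hd' k
    have h2 : q i ^ (-N) ≤ δ ^ (-N) * (1 + (a ^ 2 + b ^ 2 + c ^ 2)) ^ (-N) := by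
      rw [← Real.mul_rpow hδ.le (by positivity)]
      exact Real.rpow_le_rpow_of_nonpos hQpos (hq i) (by linarith)
    calc d i ^ k * q i ^ (-N)
        ≤ (|C| ^ k * (1 + |a|) ^ k) * (δ ^ (-N) * (1 + (a ^ 2 + b ^ 2 + c ^ 2)) ^ (-N)) :=
          mul_le_mul h1 h2 (Real.rpow_nonneg (hqpos i).le _) (by positivity)
      _ = |C| ^ k * δ ^ (-N) * ((1 + |a|) ^ k * (1 + (a ^ 2 + b ^ 2 + c ^ 2)) ^ (-N)) := by ring
  -- the fibre-summed majorant `g t := C' (1+|t.1|) h t` is summable over `ℤ³` (exponent `k + 1`)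
  have hN' : ((k + 1 : ℕ) : ℝ) + 3 < 2 * N := by push_cast; linarith
  have hg : Summable fun t : ℤ × ℤ × ℤ => C' * (1 + |(t.1 : ℝ)|) * h t := by
    refine ((summable_int3_one_add_abs_pow_mul_rpow_neg (k + 1) hN').mul_left (C' * (|C| ^ k * δ ^ (-N)))).congr fun t => ?_
    simp only [hh]
    ring
  -- summability along the fibres of `w`
  have hsig : Summable fun x : (Σ t : ℤ × ℤ × ℤ, {i // w i = t}) => d x.2.1 ^ k * q x.2.1 ^ (-N) := by
    refine (summable_sigma_of_nonneg (β := fun t : ℤ × ℤ × ℤ => {i // w i = t})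
      (f := fun x => d x.2.1 ^ k * q x.2.1 ^ (-N)) fun x => hf0 x.2.1).2 ⟨fun t => ?_, ?_⟩
    · haveI : Finite {i // w i = t} := (hfin t).to_subtype
      exact Summable.of_finite
    · refine Summable.of_nonneg_of_le (fun t => tsum_nonneg fun x => hf0 _) (fun t => ?_) hg
      haveI : Finite {i // w i = t} := (hfin t).to_subtype
      letI : Fintype {i // w i = t} := Fintype.ofFinite _
      have hcard : (Nat.card {i // w i = t} : ℝ) ≤ C' * (1 + |(t.1 : ℝ)|) := hfib t
      calc ∑' y : {i // w i = t}, d y.1 ^ k * q y.1 ^ (-N)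
          = ∑ y : {i // w i = t}, d y.1 ^ k * q y.1 ^ (-N) := tsum_fintype _
        _ ≤ ∑ _y : {i // w i = t}, h t := Finset.sum_le_sum fun y _ => by
            have hy := hfh y.1
            rw [y.2] at hy
            exact hy
        _ = (Nat.card {i // w i = t} : ℝ) * h t := by
            rw [Finset.sum_const, Finset.card_univ, nsmul_eq_mul, Nat.card_eq_fintype_card]
        _ ≤ C' * (1 + |(t.1 : ℝ)|) * h t := mul_le_mul_of_nonneg_right hcard (hh0 t)
  refine (Equiv.sigmaFiberEquiv w).summable_iff.mp ?_
  exact hsig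


/-! ## §6 (ED. 2) Finite-to-one labels with POLYNOMIAL fibre bound `#w⁻¹(t) ≤ C' (1 + |a|)^m` -/

/-- **Block form with a polynomial fibre bound** (LEAD F0P3b-p01 (g2) 2026-08-31T17:25:59Z: the growth hypothesis of ★
`UnitaryGroup.ArchIntegratedOperatorNuclearOfKTypeGrowth` carries a general exponent `r`, whence fibres `≤ c · (finrank W₀)^r`): if every fibre of
`w : ι → ℤ × ℤ × ℤ` is finite with `#w⁻¹(t) ≤ C' (1 + |t.1|)^m`, `0 ≤ d i ≤ C (1 + |a|)` and `q i ≥ δ (1 + a² + b² + c²)` (`δ > 0`), then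
`Σ_i d(i)^k q(i)^{-N} < ∞` for `(k + m) + 3 < 2N` (same proof as `summable_pow_mul_rpow_neg_of_label_fiber_le`, which is the case `m = 1`, with the
fibre-summed majorant `C'(1+|a|)^m · |C|^k (1+|a|)^k · δ^{-N}(1+a²+b²+c²)^{-N}` and `summable_int3_one_add_abs_pow_mul_rpow_neg (k + m)`).
[cite: Varadarajan1989, §5.4 Lemma 21, Thm. 19] [cite: Knapp1986, Thm. 10.2 (proof)] -/
theorem summable_pow_mul_rpow_neg_of_label_fiber_le_pow {ι : Type*} (w : ι → ℤ × ℤ × ℤ)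
    (hfin : ∀ t, (w ⁻¹' {t}).Finite) {C' : ℝ} (m : ℕ)
    (hfib : ∀ t, (Nat.card (w ⁻¹' {t}) : ℝ) ≤ C' * (1 + |(t.1 : ℝ)|) ^ m)
    {d q : ι → ℝ} {C δ : ℝ} (hδ : 0 < δ) (hd0 : ∀ i, 0 ≤ d i) (hd : ∀ i, d i ≤ C * (1 + |((w i).1 : ℝ)|))
    (hq : ∀ i, δ * (1 + (((w i).1 : ℝ) ^ 2 + ((w i).2.1 : ℝ) ^ 2 + ((w i).2.2 : ℝ) ^ 2)) ≤ q i)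
    (k : ℕ) {N : ℝ} (hN : ((k + m : ℕ) : ℝ) + 3 < 2 * N) :
    Summable fun i => d i ^ k * q i ^ (-N) := by
  -- the fibrewise-constant majorant `h (w i)` of the term
  set h : ℤ × ℤ × ℤ → ℝ := fun t =>
    |C| ^ k * δ ^ (-N) * ((1 + |(t.1 : ℝ)|) ^ k * (1 + ((t.1 : ℝ) ^ 2 + (t.2.1 : ℝ) ^ 2 + (t.2.2 : ℝ) ^ 2)) ^ (-N)) with hh
  have hh0 : ∀ t, 0 ≤ h t := fun t => by positivity
  have hqpos : ∀ i, 0 < q i := fun i => lt_of_lt_of_le (by have := hq i; positivity) (hq i)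
  have hf0 : ∀ i, 0 ≤ d i ^ k * q i ^ (-N) := fun i => mul_nonneg (pow_nonneg (hd0 i) k) (Real.rpow_nonneg (hqpos i).le _)
  have hfh : ∀ i, d i ^ k * q i ^ (-N) ≤ h (w i) := by
    intro i
    simp only [hh]
    set a : ℝ := ((w i).1 : ℝ)
    set b : ℝ := ((w i).2.1 : ℝ)
    set c : ℝ := ((w i).2.2 : ℝ)
    have hQpos : 0 < δ * (1 + (a ^ 2 + b ^ 2 + c ^ 2)) := by positivity
    have hd' : d i ≤ |C| * (1 + |a|) := (hd i).trans (mul_le_mul_of_nonneg_right (le_abs_self C) (by positivity))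
    have h1 : d i ^ k ≤ |C| ^ k * (1 + |a|) ^ k := by
      rw [← mul_pow]
      exact pow_le_pow_left₀ (hd0 i) hd' k
    have h2 : q i ^ (-N) ≤ δ ^ (-N) * (1 + (a ^ 2 + b ^ 2 + c ^ 2)) ^ (-N) := by
      rw [← Real.mul_rpow hδ.le (by positivity)]
      exact Real.rpow_le_rpow_of_nonpos hQpos (hq i) (by linarith)
    calc d i ^ k * q i ^ (-N)
        ≤ (|C| ^ k * (1 + |a|) ^ k) * (δ ^ (-N) * (1 + (a ^ 2 + b ^ 2 + c ^ 2)) ^ (-N)) :=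
          mul_le_mul h1 h2 (Real.rpow_nonneg (hqpos i).le _) (by positivity)
      _ = |C| ^ k * δ ^ (-N) * ((1 + |a|) ^ k * (1 + (a ^ 2 + b ^ 2 + c ^ 2)) ^ (-N)) := by ring
  -- the fibre-summed majorant `g t := C' (1+|t.1|)^m h t` is summable over `ℤ³` (exponent `k + m`)
  have hg : Summable fun t : ℤ × ℤ × ℤ => C' * (1 + |(t.1 : ℝ)|) ^ m * h t := by
    refine ((summable_int3_one_add_abs_pow_mul_rpow_neg (k + m) hN).mul_left (C' * (|C| ^ k * δ ^ (-N)))).congr fun t => ?_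
    simp only [hh]
    ring
  -- summability along the fibres of `w`
  have hsig : Summable fun x : (Σ t : ℤ × ℤ × ℤ, {i // w i = t}) => d x.2.1 ^ k * q x.2.1 ^ (-N) := by
    refine (summable_sigma_of_nonneg (β := fun t : ℤ × ℤ × ℤ => {i // w i = t})
      (f := fun x => d x.2.1 ^ k * q x.2.1 ^ (-N)) fun x => hf0 x.2.1).2 ⟨fun t => ?_, ?_⟩
    · haveI : Finite {i // w i = t} := (hfin t).to_subtype
      exact Summable.of_finite
    · refine Summable.of_nonneg_of_le (fun t => tsum_nonneg fun x => hf0 _) (fun t => ?_) hg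
      haveI : Finite {i // w i = t} := (hfin t).to_subtype
      letI : Fintype {i // w i = t} := Fintype.ofFinite _
      have hcard : (Nat.card {i // w i = t} : ℝ) ≤ C' * (1 + |(t.1 : ℝ)|) ^ m := hfib t
      calc ∑' y : {i // w i = t}, d y.1 ^ k * q y.1 ^ (-N)
          = ∑ y : {i // w i = t}, d y.1 ^ k * q y.1 ^ (-N) := tsum_fintype _
        _ ≤ ∑ _y : {i // w i = t}, h t := Finset.sum_le_sum fun y _ => by
            have hy := hfh y.1
            rw [y.2] at hy
            exact hy
        _ = (Nat.card {i // w i = t} : ℝ) * h t := by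
            rw [Finset.sum_const, Finset.card_univ, nsmul_eq_mul, Nat.card_eq_fintype_card]
        _ ≤ C' * (1 + |(t.1 : ℝ)|) ^ m * h t := mul_le_mul_of_nonneg_right hcard (hh0 t)
  refine (Equiv.sigmaFiberEquiv w).summable_iff.mp ?_
  exact hsig

end Literature.Analysis.SpecialFunctions

end
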